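import Summits.QuantumFields.YangMills.Theorems.LuscherReductionRunningReductionInnerPhase
import Summits.QuantumFields.YangMills.Theorems.LuscherReductionRunningReductionLatticeTopLower
import HarnessLib

/-!
# The INNER region of `(ℤ/L)³` has small magnetic energy: `orbitDist (twist3 z U) ≤ r ⇒ S(U) ≤ 8r²|P|`, so the `cos Θ_δ`-piece of the
# lattice IMS split vanishes on large fields (sub-stub C2c of the fixed-lattice programme COARSE(L₀) — route `LuscherReduction`, crux RED
# stmt-QuantumFields-19978 KT-door 3b′ / crux `TwistedTraceScaling` stmt-QuantumFields-20203 S-BASE; design note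
# `pub/ym-fleet/ym-luscher-20007-p1/COARSE-DESIGN.md` §2)

Region bookkeeping joining `…OrbitDist` (p529869), `…InnerPhase` and `…LatticeTopLower` (p525776):
* `exists_gauge_near_of_orbitDist_lt` — a configuration at orbit distance `< r` has a gauge in which EVERY link is within `r` of `1`
  (the infimum is attained);
* `wilsonAction_le_of_orbitDist_le` — hence `S(U) ≤ 8r²|P|` (gauge invariance of `S` + `wilsonAction_le_of_near_one`), and the same from a
  twisted orbit distance (`wilsonAction_twist3`: the Wilson action is twist invariant);
* `cos_innerPhase_eq_zero_of_action_gt` — if `S(U) > 8δ²|P|` then `cos Θ_δ(U) = 0`: the INNER piece `cos Θ_δ · ψ` of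
  `qform_le_inner_outer_lat` is supported in the small-action region `{S ≤ 8δ²|P|}`, the OUTER piece `sin Θ_δ · ψ` in
  `{∀ z, orbitDist (twist3 z U) > δ/2}`; the large-field layer (`qform_le_exp_neg_of_action_ge_lat`) and the (open) valley bound act on the latter.
HONEST FRAMING: region bookkeeping only; femto rung R2b1; not a gap, not Clay.
-/

set_option autoImplicit false

noncomputable section

open MeasureTheory Filter Topology Real
open scoped Matrix ComplexConjugate BigOperators
open Literature.MathematicalPhysics.QuantumFieldTheory
open Literature.MathematicalPhysics.QuantumLattice

namespace Summit.QuantumFields.YangMills.Theorems.FemtoTransferGap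

variable {L : ℕ} [NeZero L]

/-- A configuration at orbit distance `< r` has a gauge in which every link is within `r` of `1` (Frobenius). [folklore] -/
theorem exists_gauge_near_of_orbitDist_lt {U : GaugeConfig 3 L SU2} {r : ℝ} (hU : orbitDist U < r) :
    ∃ g : Site 3 L → SU2, ∀ e : Edge 3 L, frobNorm (((gaugeTransform g U e : SU2) : Matrix (Fin 2) (Fin 2) ℂ) - 1) < r := by
  obtain ⟨g, hg⟩ := exists_orbitDist_eq U
  refine ⟨g, fun e => lt_of_le_of_lt ?_ (hg ▸ hU)⟩
  unfold gaugeDist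
  exact Finset.single_le_sum (f := fun e' => frobNorm (((gaugeTransform g U e' : SU2) : Matrix (Fin 2) (Fin 2) ℂ) - 1))
    (fun e' _ => frobNorm_nonneg _) (Finset.mem_univ e)

/-- In the minimising gauge every link is within `orbitDist U` of `1`. [folklore] -/
theorem exists_gauge_le_orbitDist (U : GaugeConfig 3 L SU2) :
    ∃ g : Site 3 L → SU2, ∀ e : Edge 3 L, frobNorm (((gaugeTransform g U e : SU2) : Matrix (Fin 2) (Fin 2) ℂ) - 1) ≤ orbitDist U := by
  obtain ⟨g, hg⟩ := exists_orbitDist_eq U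
  refine ⟨g, fun e => le_of_le_of_eq ?_ hg⟩
  unfold gaugeDist
  exact Finset.single_le_sum (f := fun e' => frobNorm (((gaugeTransform g U e' : SU2) : Matrix (Fin 2) (Fin 2) ℂ) - 1))
    (fun e' _ => frobNorm_nonneg _) (Finset.mem_univ e)

/-- **Small orbit distance forces small magnetic energy**: `orbitDist U ≤ r ⇒ S(U) ≤ 8r²·|P|`. [cite: Luscher1983, §2] -/
theorem wilsonAction_le_of_orbitDist_le {U : GaugeConfig 3 L SU2} {r : ℝ} (hU : orbitDist U ≤ r) :
    wilsonAction su2Rep U ≤ 8 * r ^ 2 * Fintype.card (Plaquette 3 L) := by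
  obtain ⟨g, hg⟩ := exists_gauge_le_orbitDist U
  rw [← wilsonAction_gaugeTransform su2Rep g U]
  exact wilsonAction_le_of_near_one (gaugeTransform g U) fun e => (hg e).trans hU

/-- The Wilson action is invariant under composite centre twists. [cite: tHooft1979] -/
theorem wilsonAction_twist3 (z : Fin 3 → Bool) (U : GaugeConfig 3 L SU2) :
    wilsonAction su2Rep (TT.twist3 z U) = wilsonAction su2Rep U := by
  simp only [TT.twist3]
  rw [wilsonAction_twist_of_mem_center su2Rep 0 (TT.centreElem_mem_center _),
    wilsonAction_twist_of_mem_center su2Rep 1 (TT.centreElem_mem_center _),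
    wilsonAction_twist_of_mem_center su2Rep 2 (TT.centreElem_mem_center _)]

/-- `orbitDist (twist3 z U) ≤ r ⇒ S(U) ≤ 8r²·|P|` (the Wilson action does not see the twist). [cite: Luscher1983, §2] -/
theorem wilsonAction_le_of_orbitDist_twist3_le {U : GaugeConfig 3 L SU2} (z : Fin 3 → Bool) {r : ℝ}
    (hU : orbitDist (TT.twist3 z U) ≤ r) : wilsonAction su2Rep U ≤ 8 * r ^ 2 * Fintype.card (Plaquette 3 L) := by
  rw [← wilsonAction_twist3 z U]
  exact wilsonAction_le_of_orbitDist_le hU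

/-- ★ **The INNER piece vanishes on large fields**: if `S(U) > 8δ²|P|` then `cos Θ_δ(U) = 0` (`δ > 0`). [folklore] -/
theorem cos_innerPhase_eq_zero_of_action_gt {δ : ℝ} (hδ : 0 < δ) {U : GaugeConfig 3 L SU2}
    (hS : 8 * δ ^ 2 * Fintype.card (Plaquette 3 L) < wilsonAction su2Rep U) : Real.cos (innerPhase δ U) = 0 := by
  by_contra h
  obtain ⟨z, hz⟩ := exists_orbitDist_lt_of_cos_ne_zero hδ h
  have := wilsonAction_le_of_orbitDist_twist3_le z hz.le
  linarith

/-- Hence the INNER piece `cos Θ_δ · ψ` is supported in the small-action region `{S ≤ 8δ²|P|}`. [folklore] -/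
theorem action_le_of_cos_innerPhase_mul_ne_zero {δ : ℝ} (hδ : 0 < δ) (ψ : GaugeConfig 3 L SU2 → ℝ) {U : GaugeConfig 3 L SU2}
    (h : Real.cos (innerPhase δ U) * ψ U ≠ 0) : wilsonAction su2Rep U ≤ 8 * δ ^ 2 * Fintype.card (Plaquette 3 L) := by
  by_contra hS
  exact h (by rw [cos_innerPhase_eq_zero_of_action_gt hδ (lt_of_not_ge hS), zero_mul])

/-- And the OUTER piece `sin Θ_δ · ψ` is supported where every twisted orbit distance exceeds `δ/2`. [folklore] -/
theorem orbitDist_gt_of_sin_innerPhase_mul_ne_zero {δ : ℝ} (hδ : 0 < δ) (ψ : GaugeConfig 3 L SU2 → ℝ) {U : GaugeConfig 3 L SU2}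
    (h : Real.sin (innerPhase δ U) * ψ U ≠ 0) (z : Fin 3 → Bool) : δ / 2 < orbitDist (TT.twist3 z U) :=
  forall_lt_orbitDist_of_sin_ne_zero hδ (left_ne_zero_of_mul h) z

end Summit.QuantumFields.YangMills.Theorems.FemtoTransferGap

end
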